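import Literature.AnabelianGeometry.EtaleTheta.LogDivisorModelZTowerRays
import HarnessLib

/-!
# [EtTh] Def. 3.3 (iii) at the ℤ-tower: the CHAIN REFLECTION `n ↦ −n` of the Tate skeleton (`U ↦ U⁻¹`) — an isomorphism of the
# Def. 3.3 (iii) data of the characters `φ` and `φ⁻¹` (class (b); first piece of the «non-identity Ψ» route)

S. Mochizuki, *The étale theta function …*, Publ. RIMS **45** (2009) [MochizukiEtTh2009], §1 p.12 (the universal combinatorial
covering of a Tate curve: an infinite chain of copies of `ℙ¹`, Galois group `ℤ`; the inversion automorphism of the Tate curve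
reverses the chain), Def. 3.1 p.70, Def. 3.3 (iii) p.73 [cite: MochizukiEtTh2009, Def 3.3 p.73].

abc-iut cell, layer L2 [EtTh], seat abc-iut-w5-d179 (gen 6); VNEXT memo `VNEXT-Thm44Hyp-NonIdentityPsi-w5d179.md` (staging, sha16
acbb03ba7ee292c7), piece 1 of 3: toward a `Thm44Hyp` between the two DIFFERENT §4 settings of the ℤ-tower for `φ` and `φ⁻¹`
(`ZTowerTempered.setting X φ`, p463800) related by a NON-identity equivalence `Ψ`.  For the Tate skeleton `TateTower.model` (w6-d058)
and this seat's ℤ-tower datum `ZTower.action φ` (p460567), with two characters `φ, φ' : Γ →* ℤ` such that `φ' g = (φ g)⁻¹`: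
* `ZTower.reflectIdx / reflectDIV / reflectFn` — the involution of the skeleton: `F_n ↦ F_{−n}` on prime log-divisors, `d ↦ d ∘ (n ↦ −n)`
  on `DIV`, `ϖ^c U^k ↦ ϖ^c U^{−k}` on `Fn`; it preserves effectivity, constants, and commutes with `divisor`
  (`mlt_divisor_reflectFn`); and it INTERTWINES the two actions: `reflectDIV ∘ (g·)_{φ} = (g·)_{φ'} ∘ reflectDIV`
  (`reflectDIV_actDIV`, `reflectFn_actFn`);
* **`ZTower.reflectPhiZero φ φ' hφ S : Φ₀^{φ}(S) ≃* Φ₀^{φ'}(S)`** and **`ZTower.reflectBZero … : B₀^{φ}(S) ≃* B₀^{φ'}(S)`** — natural in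
  `S` (`reflectPhiZero_phiZeroPull`), on coordinates `coord (s, n) ↦ coord (s, −n)` (`coord_reflectPhiZero`), `diag ↦ diag`,
  `cnstFn c ↦ cnstFn c`, `F₀ ↦ F₀`, and compatible with «divisor of zeroes and poles»: `divAt (reflect b) s = reflectDIV (divAt b s)`,
  `div₀ (reflect b) = [reflect (divNum b)] / [reflect (divDen b)]` (`divZeroHom_reflectBZero`).
So the Def. 3.3 (iii) data `ZTowerTempered.dm X φ` and `ZTowerTempered.dm X φ⁻¹` are isomorphic over the identity of the base;
pieces 2–3 (realification transport; `ModelFrobenioid.DataHomOver.functor_isEquivalence` ⇒ `Ψ`, then `Thm44Hyp` + this lineage's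
closers BY NAME) are the memo's sequel.  Class (b): 5 defs (`reflectIdx`, `reflectDIV`, `reflectFn`, `reflectPhiZero`, `reflectBZero`)
+ theorems; no Prop fact, no instance, no notation, no sorry.  HONEST FRAMING: combinatorial model; nothing here bears on [IUTchIII]
Cor. 3.12; typed ≠ proved.
-/

noncomputable section

namespace Literature.AnabelianGeometry.EtaleTheta

open CategoryTheory Literature.AlgebraicGeometry.Frobenioids

namespace LogDivisorModel.ZTower

open TateTower GaloisAction

/-! ### The reflection of the skeleton -/

/-- The reflection of the prime log-divisors: `F_n ↦ F_{−n}` (no cusps). [cite: MochizukiEtTh2009, Def 3.1 p.70] -/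
def reflectIdx : TateTower.Idx ≃ TateTower.Idx := Equiv.sumCongr (Equiv.refl _) (Equiv.neg ℤ)

/-- `reflectIdx (F_n) = F_{−n}`. [cite: MochizukiEtTh2009, Def 3.1 p.70] -/
@[simp] theorem reflectIdx_inr (n : ℤ) : reflectIdx (Sum.inr n) = Sum.inr (-n) := rfl

/-- The reflection is an involution. [cite: MochizukiEtTh2009, Def 3.1 p.70] -/
theorem reflectIdx_reflectIdx (x : TateTower.Idx) : reflectIdx (reflectIdx x) = x := by
  rcases x with c | n
  · exact c.elim
  · rw [reflectIdx_inr, reflectIdx_inr, neg_neg]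

/-- Positions are negated: `pos (reflectIdx x) = − pos x`. [cite: MochizukiEtTh2009, Def 3.1 p.70] -/
theorem pos_reflectIdx (x : TateTower.Idx) : pos (reflectIdx x) = -pos x := by
  rcases x with c | n
  · exact c.elim
  · rfl

/-- **The reflection of log-divisors**: `d ↦ d ∘ (n ↦ −n)`, a group automorphism of `DIV(Z_∞)`. [cite: MochizukiEtTh2009, Def 3.1 p.70] -/
def reflectDIV : model.DIV ≃* model.DIV where
  toFun d := Multiplicative.ofAdd (α := TateTower.Idx → ℤ) fun x => mlt d (reflectIdx x)
  invFun d := Multiplicative.ofAdd (α := TateTower.Idx → ℤ) fun x => mlt d (reflectIdx x)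
  left_inv d := ext_mlt fun x => by
    show mlt d (reflectIdx (reflectIdx x)) = mlt d x
    rw [reflectIdx_reflectIdx]
  right_inv d := ext_mlt fun x => by
    show mlt d (reflectIdx (reflectIdx x)) = mlt d x
    rw [reflectIdx_reflectIdx]
  map_mul' a b := ext_mlt fun x => by
    show mlt (a * b) (reflectIdx x) = mlt a (reflectIdx x) + mlt b (reflectIdx x)
    rw [mlt_mul]

/-- Multiplicities of the reflected log-divisor. [cite: MochizukiEtTh2009, Def 3.1 p.70] -/
theorem mlt_reflectDIV (d : model.DIV) (x : TateTower.Idx) : mlt (reflectDIV d) x = mlt d (reflectIdx x) := rfl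

/-- Multiplicities of the reflected log-divisor along the components: `mlt (reflect d) n = mlt d (−n)`. [cite: MochizukiEtTh2009, Def 3.1 p.70] -/
theorem mlt_reflectDIV_inr (d : model.DIV) (n : ℤ) : mlt (reflectDIV d) (Sum.inr n) = mlt d (Sum.inr (-n)) := rfl

/-- The reflection is an involution on log-divisors. [cite: MochizukiEtTh2009, Def 3.1 p.70] -/
theorem reflectDIV_reflectDIV (d : model.DIV) : reflectDIV (reflectDIV d) = d := reflectDIV.left_inv d

/-- The reflection preserves effectivity (and Cartier-ness). [cite: MochizukiEtTh2009, Def 3.1 p.70] -/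
theorem reflectDIV_mem_Divplus {d : model.DIV} (hd : d ∈ model.Divplus) : reflectDIV d ∈ model.Divplus :=
  mem_Divplus_of_nonneg fun x => by rw [mlt_reflectDIV]; exact mlt_nonneg_of_mem_Divplus hd _

/-- The reflection fixes the special fibre `Σ_n [F_n]`. [cite: MochizukiEtTh2009, Def 3.1 p.70] -/
@[simp] theorem reflectDIV_ones : reflectDIV ones = ones := ext_mlt fun x => by rw [mlt_reflectDIV, mlt_ones, mlt_ones]

/-- **The reflection of functions**: `ϖ^c U^k ↦ ϖ^c U^{−k}` (`U ↦ U⁻¹`), a group automorphism of `Mero(Z_∞)`. [cite: MochizukiEtTh2009, Def 3.1 p.70] -/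
def reflectFn : model.Fn ≃* model.Fn where
  toFun f := fn (expC f) (-expU f)
  invFun f := fn (expC f) (-expU f)
  left_inv f := ext_exp rfl (by show -(-expU f) = expU f; rw [neg_neg])
  right_inv f := ext_exp rfl (by show -(-expU f) = expU f; rw [neg_neg])
  map_mul' a b := ext_exp (by show expC (a * b) = expC a + expC b; rw [expC_mul])
    (by show -expU (a * b) = -expU a + -expU b; rw [expU_mul, neg_add])

/-- The `ϖ`-exponent is unchanged by the reflection. [cite: MochizukiEtTh2009, Def 3.1 p.70] -/
@[simp] theorem expC_reflectFn (f : model.Fn) : expC (reflectFn f) = expC f := rfl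

/-- The `U`-exponent is negated by the reflection. [cite: MochizukiEtTh2009, Def 3.1 p.70] -/
@[simp] theorem expU_reflectFn (f : model.Fn) : expU (reflectFn f) = -expU f := rfl

/-- The reflection is an involution on functions. [cite: MochizukiEtTh2009, Def 3.1 p.70] -/
theorem reflectFn_reflectFn (f : model.Fn) : reflectFn (reflectFn f) = f := reflectFn.left_inv f

/-- Constants are reflection-fixed. [cite: MochizukiEtTh2009, Def 3.1 p.70] -/
theorem reflectFn_of_mem_const {f : model.Fn} (hf : f ∈ model.const) : reflectFn f = f :=
  ext_exp rfl (by rw [expU_reflectFn, (mem_const_iff f).1 hf, neg_zero])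

/-- The reflection preserves the constants. [cite: MochizukiEtTh2009, Def 3.1 p.70] -/
theorem reflectFn_mem_const {f : model.Fn} (hf : f ∈ model.const) : reflectFn f ∈ model.const := by
  rw [reflectFn_of_mem_const hf]; exact hf

/-- **The reflection commutes with «divisor of zeroes and poles»**: `div(ϖ^c U^{−k}) = reflect (div(ϖ^c U^k))`.
[cite: MochizukiEtTh2009, Def 3.1 p.70] -/
theorem divisor_reflectFn (f : model.logMero) :
    model.divisor ⟨reflectFn f.1, trivial⟩ = reflectDIV (model.divisor f) :=
  ext_mlt fun x => by rw [mlt_divisor, mlt_reflectDIV, mlt_divisor, expC_reflectFn, expU_reflectFn, pos_reflectIdx, neg_mul, mul_neg]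

/-! ### Two characters `φ, φ'` with `φ' = φ⁻¹`: the reflection intertwines the two actions -/

variable {Γ : Type} [Group Γ] (φ φ' : Γ →* Multiplicative ℤ) (hφ : ∀ g : Γ, φ' g = (φ g)⁻¹)

include hφ in
/-- The translation parameter of `φ'` is minus that of `φ`. [cite: MochizukiEtTh2009, Def 3.3 p.73] -/
theorem toAdd_eq_neg (g : Γ) : Multiplicative.toAdd (φ' g) = -Multiplicative.toAdd (φ g) := by rw [hφ, toAdd_inv]

include hφ in
/-- **The reflection intertwines the actions on log-divisors**: `reflect (g·_{φ} d) = g·_{φ'} (reflect d)`.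
[cite: MochizukiEtTh2009, Def 3.3 p.73] -/
theorem reflectDIV_actDIV (g : Γ) (d : model.DIV) :
    reflectDIV ((action φ).actDIV g d) = (action φ').actDIV g (reflectDIV d) :=
  ext_mlt fun x => by
    rcases x with c | n
    · exact c.elim
    · rw [mlt_reflectDIV_inr, mlt_actDIV_inr, mlt_actDIV_inr, mlt_reflectDIV_inr, toAdd_eq_neg φ φ' hφ]
      congr 2
      ring

include hφ in
/-- **The reflection intertwines the actions on functions**: `reflect (g·_{φ} f) = g·_{φ'} (reflect f)`.
[cite: MochizukiEtTh2009, Def 3.3 p.73] -/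
theorem reflectFn_actFn (g : Γ) (f : model.Fn) : reflectFn ((action φ).actFn g f) = (action φ').actFn g (reflectFn f) :=
  ext_exp (by rw [expC_reflectFn, expC_actFn, expC_actFn, expC_reflectFn, expU_reflectFn, toAdd_eq_neg φ φ' hφ, neg_mul_neg])
    (by rw [expU_reflectFn, expU_actFn, expU_actFn, expU_reflectFn])

variable (S : Action (Type 0) Γ)

include hφ in
/-- The reflection applied pointwise to an element of `Φ₀^{φ}(S)` is an element of `Φ₀^{φ'}(S)`. [cite: MochizukiEtTh2009, Def 3.3 p.73] -/
theorem reflect_mem_phiZero (ψ : (action φ).phiZero S) : (fun s => reflectDIV (ψ.1 s)) ∈ (action φ').phiZero S :=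
  ⟨fun s => reflectDIV_mem_Divplus (ψ.2.1 s), fun g s => by
    show reflectDIV (ψ.1 (S.ρ g s)) = (action φ').actDIV g (reflectDIV (ψ.1 s))
    rw [ψ.2.2 g s, reflectDIV_actDIV φ φ' hφ]⟩

include hφ in
/-- **`Φ₀^{φ}(S) ≃* Φ₀^{φ'}(S)`** by pointwise reflection (the inverse by reflecting back, `φ = (φ')⁻¹`).
[cite: MochizukiEtTh2009, Def 3.3 p.73] -/
def reflectPhiZero : (action φ).phiZero S ≃* (action φ').phiZero S where
  toFun ψ := ⟨fun s => reflectDIV (ψ.1 s), reflect_mem_phiZero φ φ' hφ S ψ⟩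
  invFun χ := ⟨fun s => reflectDIV (χ.1 s), reflect_mem_phiZero φ' φ (fun g => by rw [hφ, inv_inv]) S χ⟩
  left_inv ψ := Subtype.ext (funext fun s => reflectDIV_reflectDIV (ψ.1 s))
  right_inv χ := Subtype.ext (funext fun s => reflectDIV_reflectDIV (χ.1 s))
  map_mul' ψ ψ' := Subtype.ext (funext fun s => by
    show reflectDIV ((ψ * ψ').1 s) = reflectDIV (ψ.1 s) * reflectDIV (ψ'.1 s)
    rw [Submonoid.coe_mul, Pi.mul_apply, map_mul])

/-- `reflectPhiZero`, pointwise. [cite: MochizukiEtTh2009, Def 3.3 p.73] -/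
@[simp] theorem reflectPhiZero_apply (ψ : (action φ).phiZero S) (s : S.V) : (reflectPhiZero φ φ' hφ S ψ).1 s = reflectDIV (ψ.1 s) := rfl

/-- **On coordinates the reflection is `(s, n) ↦ (s, −n)`.** [cite: MochizukiEtTh2009, Rmk 3.3.1 p.73] -/
theorem coord_reflectPhiZero (ψ : (action φ).phiZero S) (s : S.V) (n : ℤ) :
    coord φ' S s n (reflectPhiZero φ φ' hφ S ψ) = coord φ S s (-n) ψ := by
  rw [coord_apply, coord_apply, reflectPhiZero_apply, mlt_reflectDIV_inr]

/-- The reflection carries the diagonal to the diagonal. [cite: MochizukiEtTh2009, Def 3.3 p.73] -/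
@[simp] theorem reflectPhiZero_diag : reflectPhiZero φ φ' hφ S (diag φ S) = diag φ' S :=
  Subtype.ext (funext fun s => by rw [reflectPhiZero_apply, diag_apply, diag_apply, reflectDIV_ones])

/-- **Naturality in `S`**: reflection commutes with pull-back along covering maps. [cite: MochizukiEtTh2009, Def 3.3 p.73] -/
theorem reflectPhiZero_phiZeroPull {S' : Action (Type 0) Γ} (f : S ⟶ S') (ψ : (action φ).phiZero S') :
    reflectPhiZero φ φ' hφ S ((action φ).phiZeroPull f ψ) = (action φ').phiZeroPull f (reflectPhiZero φ φ' hφ S' ψ) := rfl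

include hφ in
/-- The reflection applied pointwise to an element of `B₀^{φ}(S)` is an element of `B₀^{φ'}(S)`. [cite: MochizukiEtTh2009, Def 3.3 p.73] -/
theorem reflect_mem_bZero (b : (action φ).bZero S) : (fun s => reflectFn (b.1 s)) ∈ (action φ').bZero S :=
  ⟨fun _ => trivial, fun g s => by
    show reflectFn (b.1 (S.ρ g s)) = (action φ').actFn g (reflectFn (b.1 s))
    rw [b.2.2 g s, reflectFn_actFn φ φ' hφ]⟩

include hφ in
/-- **`B₀^{φ}(S) ≃* B₀^{φ'}(S)`** by pointwise reflection `U ↦ U⁻¹`. [cite: MochizukiEtTh2009, Def 3.3 p.73] -/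
def reflectBZero : (action φ).bZero S ≃* (action φ').bZero S where
  toFun b := ⟨fun s => reflectFn (b.1 s), reflect_mem_bZero φ φ' hφ S b⟩
  invFun b := ⟨fun s => reflectFn (b.1 s), reflect_mem_bZero φ' φ (fun g => by rw [hφ, inv_inv]) S b⟩
  left_inv b := Subtype.ext (funext fun s => reflectFn_reflectFn (b.1 s))
  right_inv b := Subtype.ext (funext fun s => reflectFn_reflectFn (b.1 s))
  map_mul' b b' := Subtype.ext (funext fun s => by
    show reflectFn ((b * b').1 s) = reflectFn (b.1 s) * reflectFn (b'.1 s)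
    rw [Subgroup.coe_mul, Pi.mul_apply, map_mul])

/-- `reflectBZero`, pointwise. [cite: MochizukiEtTh2009, Def 3.3 p.73] -/
@[simp] theorem reflectBZero_apply (b : (action φ).bZero S) (s : S.V) : (reflectBZero φ φ' hφ S b).1 s = reflectFn (b.1 s) := rfl

/-- The reflection fixes the constant functions `ϖ^c`. [cite: MochizukiEtTh2009, Def 3.3 p.73] -/
@[simp] theorem reflectBZero_cnstFn (c : ℤ) : reflectBZero φ φ' hφ S (cnstFn φ S c) = cnstFn φ' S c :=
  Subtype.ext (funext fun s => by rw [reflectBZero_apply, cnstFn_apply, cnstFn_apply, reflectFn_of_mem_const (fn_zero_mem_const c)])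

/-- The reflection carries `F₀^{φ}(S)` into `F₀^{φ'}(S)`. [cite: MochizukiEtTh2009, Def 3.3 p.73] -/
theorem reflectBZero_mem_fZero {b : (action φ).bZero S} (hb : b ∈ (action φ).fZero S) :
    reflectBZero φ φ' hφ S b ∈ (action φ').fZero S := fun s => reflectFn_mem_const (hb s)

/-- Naturality in `S` for `B₀`. [cite: MochizukiEtTh2009, Def 3.3 p.73] -/
theorem reflectBZero_bZeroPull {S' : Action (Type 0) Γ} (f : S ⟶ S') (b : (action φ).bZero S') :
    reflectBZero φ φ' hφ S ((action φ).bZeroPull f b) = (action φ').bZeroPull f (reflectBZero φ φ' hφ S' b) := rfl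

/-- **The reflection commutes with the pointwise divisor**: `div((reflect b) s) = reflect (div(b s))`.
[cite: MochizukiEtTh2009, Def 3.3 p.73] -/
theorem divAt_reflectBZero (b : (action φ).bZero S) (s : S.V) :
    (action φ').divAt S (reflectBZero φ φ' hφ S b) s = reflectDIV ((action φ).divAt S b s) :=
  divisor_reflectFn ⟨b.1 s, b.2.1 s⟩

/-- **The reflection commutes with «divisor of zeroes and poles» `div₀ : B₀ → Φ₀^gp`**: `div₀ (reflect b)` is the quotient of the
reflected numerator and denominator of `div₀ b` (whose quotient is `div₀ b`, `divZero`). [cite: MochizukiEtTh2009, Def 3.3 p.73] -/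
theorem divZeroHom_reflectBZero (b : (action φ).bZero S) :
    (action φ').divZeroHom S (reflectBZero φ φ' hφ S b) =
      Algebra.GrothendieckGroup.of (reflectPhiZero φ φ' hφ S ((action φ).divNum S b)) /
        Algebra.GrothendieckGroup.of (reflectPhiZero φ φ' hφ S ((action φ).divDen S b)) :=
  ((action φ').divZeroHom_eq_div_iff S _ _ _).2 fun s => by
    rw [divAt_reflectBZero, reflectPhiZero_apply, reflectPhiZero_apply, ← map_mul, (action φ).divAt_mul_divDen S b s]

/-- For comparison: `div₀ b` itself is the quotient of numerator and denominator (by definition).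
[cite: MochizukiEtTh2009, Def 3.3 p.73] -/
theorem divZeroHom_eq_numDen (b : (action φ).bZero S) :
    (action φ).divZeroHom S b =
      Algebra.GrothendieckGroup.of ((action φ).divNum S b) / Algebra.GrothendieckGroup.of ((action φ).divDen S b) := rfl

/-! ### Non-vacuity: the pair `(φ, φ⁻¹)` -/

/-- The hypothesis `φ' = φ⁻¹` pointwise is met by the inverse character `g ↦ (φ g)⁻¹` (a homomorphism since `ℤ` is commutative).
[cite: MochizukiEtTh2009, Def 3.3 p.73] -/
theorem inv_apply_eq (g : Γ) : (φ⁻¹ : Γ →* Multiplicative ℤ) g = (φ g)⁻¹ := rfl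

/-- **Non-vacuity**: `Φ₀^{φ}(S) ≃* Φ₀^{φ⁻¹}(S)` for every group, character and covering. [cite: MochizukiEtTh2009, Def 3.3 p.73] -/
theorem nonempty_mulEquiv_phiZero_inv :
    Nonempty ((action φ).phiZero S ≃* (action φ⁻¹).phiZero S) :=
  ⟨reflectPhiZero φ φ⁻¹ (inv_apply_eq φ) S⟩

end LogDivisorModel.ZTower

end Literature.AnabelianGeometry.EtaleTheta

end
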